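import Mathlib
import Literature.IUT.LogVolume.UnitLogNormTrace
import Literature.IUT.LogVolume.UnitLogKernel

/-!
# STUB IDEAS k1·g34 — `stub_heegnerIndexLowerAtTwo` — R213′ / C2 / C1 by WEAKEN / STRENGTHEN:
# «ONE TRACE-ONE UNIT PER STEP IS THE WHOLE NORM-SURJECTIVITY INPUT OF THE INSTANTIATION LEG AT `v`»

Technique of this seat: *weaken / strengthen* (weakest sufficient form / strongest provable form), applied to the
ORDER-NOW typer items of STUB-PLAN v6.7 (CRITIC-ROWS-g35 rows 100–102) that carry NORM-SURJECTIVITY content: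

* **R213′** = (G1) `IsAdicComplete 𝔪 𝒪_{L_{m+1}}` for the closed unit ball + (G2) `τ_m` restricts to the ball +
  (G3) `∃ a, ‖a‖ ≤ 1 ∧ ‖τ_m a − a‖ = 1` — the glue pricing (row 102, P1) of k3-g34's sub-stub
  `NormOntoPrincipal (L m) (L (m+1))` (row 100, the `hN` binder of `tower_univNorm_eq_prQuot` = `U_n = D_n`, and of
  row 101's H2 `D₀ ⊆ Im q₀`) via the tree theorem `UnramifiedQuadraticNorm.exists_mul_map_eq_of_sub_one_mem`;
* **C2** (`hH0_transition_bijective`, LCFT Harari Prop. 9.7 (a)) and **C1** (`#(U¹(F_m)/N_Δ U¹(L_m)) = 2`, LCFT) — the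
  prices (row 102, P2 (β)) of the coinvariant comparison `θ = lim (1−σ)̄ : lim_N Q_m ↠ lim_N S_m`, `ker θ = ℤ/2`.

WEAKEST SUFFICIENT FORM (this file, kernel-checked, 0 sorry):  all of it follows from ONE FRAME DATUM per step,
  `(TR1)_m :  ∃ b : F_{m+1} (↪ L_{m+1}),  ‖b‖ ≤ 1  ∧  b + τ_m b = 1`,
consumed by a 40-line theorem IN THE CONSUMER'S OWN (`LogVolume`) FRAME — a one-variable contraction in the complete
base field: `N(1 + c·b) = 1 + c·(b+τb) + c²·(b·τb) = 1 + c + N(b)c²`, and `c ↦ a − N(b)c²` contracts the ball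
`‖c‖ ≤ ‖a‖` (`a := y − 1`, Lipschitz constant `‖a‖ < 1`, Banach `ContractingWith.exists_fixedPoint'`).  Consequences:
  (G1), (G2) are NOT NEEDED (no `IsAdicComplete`, no `Valued` transport, no restriction of `τ` to the ball, no residue
  field, no tree-module import — `CompleteSpace (L m)` is an instance from the frame's `ProperSpace`);
  (G3) is consumed in its weakest currency (TR1) (conversions `moved-by-a-unit ⟹ unit trace ⟹ (TR1)` in §2);
  C2 is NOT NEEDED: the kernel transition `Ĥ⁰(Δ_{m+1}, U¹(L_{m+1})) → Ĥ⁰(Δ_m, U¹(L_m))` is induced by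
  `N_{F_{m+1}/F_m}` on representatives `w ∈ U¹(F_{m+1})`, so `hker` (kernels ONTO kernels, the hypothesis of k2-g35's
  `exists_coherent_lift`) IS `NormOntoPrincipal (F m) (F (m+1))` — the SAME theorem on the `F`-tower, fed by the SAME
  element `b_m ∈ F_{m+1}` (§2 `traceOne_map`: one datum serves both towers);
  C1 is NOT NEEDED on the LOWER path (`hext` only uses that `ker θ = lim Ĥ⁰` is killed by `2`); it survives on the
  R200′(a) RECONCILIATION ledger only, where (§3–§4) the lower bound `ker θ ≠ 0` is UNCONDITIONAL (layer-0 non-norm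
  units, `decide`d, propagated by `exists_coherent_kernel_ne_one`) and the upper bound `#Ĥ⁰_m ≤ 2` has a
  RECIPROCITY-FREE route: Herbrand `h(Δ_m, U¹(L_m)) = 1` [Harari L. 8.1 / Prop. 8.2 proof; tree
  `Herbrand.herbrandQuotient_eq_mul`, `…_eq_one_of_finite`] and `#Ĥ⁻¹ = [S_m : D_m] = 2` (tree, k2-g32) — C1 ↦ C1′.
STRONGEST PROVABLE FORM (same proof): the solution respects the whole filtration, `‖1 − z‖ ≤ ‖1 − y‖` — Serre V §2
Prop. 3 (a) `N(U^n_L) = U^n_K` for ALL `n ≥ 1` at once, indeed V §3 Cor. 3 at `t = 0`: the lemma never uses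
"unramified", only (TR1), which holds iff `Tr(𝒪_{k'}) = 𝒪_k` (TAME; at `p = 2` in degree `2`: iff unramified) and is
also NECESSARY (wild ⟹ `U¹_K ⊄ N U¹_L`, Serre XV §2) — (TR1) is the weakest possible frame datum.

§1a contraction · §1b (N-ONTO) ⟸ (TR1), filtered · §1c tower form (= the literal `hN` binder) · §2 producing and
transporting (TR1) · §3 non-injectivity of `θ` from a layer-0 kernel class · §4 layer-0 non-norm units, `decide`d.
BSD is NOT proved by any of this; nothing here touches `Theorems/`; k2-g35's `exists_coherent_lift` / `delta_*` and
k3-g34's carrier square are CITED, not re-derived (K43 / K45).  0 sorry.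
-/

namespace Summit.BirchSwinnertonDyer.BirchSwinnertonDyer.Cruxes.SplitBadTwoLowerHalfOfFacts.NormOntoK1G34

open Literature.IUT.LogVolume

/-! ## §1a  The one-variable contraction in the (complete, ultrametric) base field -/

section Contraction

variable {k : Type*} [NontriviallyNormedField k] [IsUltrametricDist k] [CompleteSpace k]

/-- **Dyadic Newton step, closed form.**  For `‖a‖ < 1` and `‖n‖ ≤ 1` the equation `c + n·c² = a`
has a solution with `‖c‖ ≤ ‖a‖`: the map `c ↦ a − n·c²` preserves the closed ball of radius `‖a‖`
and is `‖a‖`-Lipschitz there (`‖c + c'‖ ≤ ‖a‖` ultrametrically), so Banach's fixed-point theorem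
(`ContractingWith.exists_fixedPoint'`) applies.  No residue field, no discreteness. -/
theorem exists_root_quadratic_contraction (a n : k) (ha : ‖a‖ < 1) (hn : ‖n‖ ≤ 1) :
    ∃ c : k, ‖c‖ ≤ ‖a‖ ∧ c + n * c ^ 2 = a := by
  have hmaps : Set.MapsTo (fun c : k => a - n * c ^ 2) (Metric.closedBall (0 : k) ‖a‖)
      (Metric.closedBall (0 : k) ‖a‖) := by
    intro c hc
    rw [Metric.mem_closedBall, dist_zero_right] at hc ⊢
    have h1 : ‖n‖ * ‖c‖ ^ 2 ≤ ‖c‖ ^ 2 := mul_le_of_le_one_left (sq_nonneg _) hn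
    have h2 : ‖c‖ ^ 2 ≤ ‖a‖ ^ 2 := pow_le_pow_left₀ (norm_nonneg _) hc 2
    have h3 : ‖a‖ ^ 2 ≤ ‖a‖ := by
      rw [sq]; exact mul_le_of_le_one_right (norm_nonneg _) ha.le
    calc ‖a - n * c ^ 2‖ ≤ max ‖a‖ ‖-(n * c ^ 2)‖ := by
          rw [sub_eq_add_neg]; exact IsUltrametricDist.norm_add_le_max _ _
      _ ≤ ‖a‖ := by
          rw [norm_neg, norm_mul, norm_pow]
          exact max_le le_rfl (h1.trans (h2.trans h3))
  have hK : ‖a‖₊ < 1 := by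
    rw [← NNReal.coe_lt_coe, coe_nnnorm, NNReal.coe_one]; exact ha
  have hcontr : ContractingWith ‖a‖₊ (hmaps.restrict _ _ _) := by
    refine ⟨hK, LipschitzWith.of_dist_le_mul fun x y => ?_⟩
    obtain ⟨x, hx⟩ := x
    obtain ⟨y, hy⟩ := y
    rw [Metric.mem_closedBall, dist_zero_right] at hx hy
    rw [Subtype.dist_eq, Set.MapsTo.val_restrict_apply, Set.MapsTo.val_restrict_apply,
      dist_eq_norm, Subtype.dist_eq, dist_eq_norm, coe_nnnorm]
    have hxy : ‖x + y‖ ≤ ‖a‖ := (IsUltrametricDist.norm_add_le_max x y).trans (max_le hx hy)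
    have heq : a - n * x ^ 2 - (a - n * y ^ 2) = -(n * ((x + y) * (x - y))) := by ring
    show ‖a - n * x ^ 2 - (a - n * y ^ 2)‖ ≤ ‖a‖ * ‖x - y‖
    rw [heq, norm_neg, norm_mul, norm_mul]
    calc ‖n‖ * (‖x + y‖ * ‖x - y‖) ≤ 1 * (‖a‖ * ‖x - y‖) := by gcongr
      _ = ‖a‖ * ‖x - y‖ := one_mul _
  have h0 : (0 : k) ∈ Metric.closedBall (0 : k) ‖a‖ := by
    rw [Metric.mem_closedBall, dist_self]; exact norm_nonneg _
  obtain ⟨c, hcs, hfix, -⟩ :=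
    hcontr.exists_fixedPoint' Metric.isClosed_closedBall.isComplete hmaps h0 (edist_ne_top _ _)
  rw [Metric.mem_closedBall, dist_zero_right] at hcs
  refine ⟨c, hcs, ?_⟩
  have h : a - n * c ^ 2 = c := hfix
  linear_combination (-1 : k) * h

end Contraction

/-! ## §1b  One quadratic step in the `LogVolume` frame: (N-ONTO) ⟸ (TR1) -/

section LevelPair

variable {k k' : Type} [NontriviallyNormedField k] [NormedAlgebra ℚ_[2] k] [IsUltrametricDist k]
  [ProperSpace k] [NontriviallyNormedField k'] [NormedAlgebra ℚ_[2] k'] [IsUltrametricDist k']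
  [ProperSpace k'] [Algebra k k'] [IsScalarTower ℚ_[2] k k']

/-- SUB-STUB (N-ONTO) — VERBATIM the `def` of k3-g34 (`CarrierSquareK3G34.NormOntoPrincipal`), so the
theorems below plug into `prQuot_subset_norm_image` / `tower_univNorm_eq_prQuot` by `Iff.rfl`. -/
def NormOntoPrincipal (k k' : Type) [NontriviallyNormedField k] [NontriviallyNormedField k']
    [Algebra k k'] : Prop :=
  ∀ y : k, IsPrincipal y → ∃ z : k', IsPrincipal z ∧ Algebra.norm k z = y

/-- **(TR1) the trace-one datum** of a quadratic step with involution `τ`: a unit-ball element of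
trace one.  This is the WEAKEST SUFFICIENT frame input for (N-ONTO) found by this seat; it holds iff
`Tr(𝒪_{k'}) = 𝒪_k` (tame ramification; at `p = 2` in degree `2`: iff unramified) and FAILS for the
ramified steps `L_m/F_m` (where `Ĥ⁰ ≠ 0`, §3–§4). -/
def TraceOne (τ : k' ≃ₐ[k] k') : Prop :=
  ∃ b : k', ‖b‖ ≤ 1 ∧ b + τ b = 1

omit [IsUltrametricDist k] [IsUltrametricDist k'] [ProperSpace k'] in
/-- `‖algebraMap k k' y‖ = ‖y‖` (tree `norm_map_algHom`; as in k3-g34). -/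
theorem norm_algebraMap_eq' (y : k) : ‖algebraMap k k' y‖ = ‖y‖ := by
  have := norm_map_algHom (IsScalarTower.toAlgHom ℚ_[2] k k') y
  simpa using this

omit [IsUltrametricDist k'] in
/-- **STRONGEST PROVABLE FORM (filtered N-ONTO), from (TR1).**  If `N z = z·τz` and `b + τb = 1` with
`‖b‖ ≤ 1`, then every `y` with `‖1 − y‖ < 1` is a norm `N z = y` of some `z` with `‖1 − z‖ ≤ ‖1 − y‖` —
i.e. `N(U^ρ(k')) ⊇ U^ρ(k)` for every radius `ρ < 1` simultaneously (Serre V §2 Prop. 3 (a) for all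
`n`, V §3 Cor. 3 at `t = 0`).  Proof: `z := 1 + c·b` with `c + N(b)·c² = y − 1` from §1a; then
`z·τz = 1 + c(b+τb) + c²·bτb = 1 + c + N(b)c² = y` inside `k'`, and `algebraMap` is injective. -/
theorem exists_norm_eq_of_traceOne (τ : k' ≃ₐ[k] k')
    (hNτ : ∀ z : k', algebraMap k k' (Algebra.norm k z) = z * τ z)
    {b : k'} (hb : ‖b‖ ≤ 1) (htr : b + τ b = 1) {y : k} (hy : ‖1 - y‖ < 1) :
    ∃ z : k', ‖1 - z‖ ≤ ‖1 - y‖ ∧ Algebra.norm k z = y := by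
  have hτb : ‖τ b‖ = ‖b‖ := norm_map_algHom ((τ : k' →ₐ[k] k').restrictScalars ℚ_[2]) b
  have hn₁ : ‖Algebra.norm k b‖ ≤ 1 := by
    rw [← norm_algebraMap_eq' (k' := k') (Algebra.norm k b), hNτ b, norm_mul, hτb]
    exact mul_le_one₀ hb (norm_nonneg _) hb
  have ha : ‖y - 1‖ < 1 := by rw [← norm_neg, neg_sub]; exact hy
  obtain ⟨c, hc, hroot⟩ := exists_root_quadratic_contraction (y - 1) (Algebra.norm k b) ha hn₁
  refine ⟨1 + algebraMap k k' c * b, ?_, ?_⟩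
  · rw [sub_add_cancel_left, norm_neg, norm_mul, norm_algebraMap_eq']
    calc ‖c‖ * ‖b‖ ≤ ‖y - 1‖ * 1 := by gcongr
      _ = ‖1 - y‖ := by rw [mul_one, ← norm_neg, neg_sub]
  · apply (algebraMap k k').injective
    have hbb : b * τ b = algebraMap k k' (Algebra.norm k b) := (hNτ b).symm
    have hτb' : τ b = 1 - b := by rw [← htr]; ring
    have hy' : y = 1 + (c + Algebra.norm k b * c ^ 2) := by rw [hroot]; ring
    rw [hNτ, map_add, map_one, map_mul, AlgEquiv.commutes, hy', map_add, map_one, map_add, map_mul,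
      map_pow, ← hbb, hτb']
    ring

omit [IsUltrametricDist k'] in
/-- **R213 (N-ONTO) from (TR1)** — the statement consumed by k3-g34 `prQuot_subset_norm_image` and
`tower_univNorm_eq_prQuot (hN)`, now reduced to one frame datum per step. -/
theorem normOntoPrincipal_of_traceOne (τ : k' ≃ₐ[k] k')
    (hNτ : ∀ z : k', algebraMap k k' (Algebra.norm k z) = z * τ z) (h : TraceOne τ) :
    NormOntoPrincipal k k' := by
  intro y hy
  obtain ⟨b, hb, htr⟩ := h
  obtain ⟨z, hz, hNz⟩ := exists_norm_eq_of_traceOne τ hNτ hb htr hy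
  exact ⟨z, lt_of_le_of_lt hz hy, hNz⟩

/-! ## §2  Producing the trace-one datum on the carriers -/

omit [NormedAlgebra ℚ_[2] k] [IsUltrametricDist k] [ProperSpace k] [NormedAlgebra ℚ_[2] k']
  [IsUltrametricDist k'] [ProperSpace k'] [IsScalarTower ℚ_[2] k k'] in
/-- (TR1) from any integral element whose trace is a UNIT: `b := x·(x+τx)⁻¹` (the trace `x + τx` is
`τ`-fixed and pulls out).  On B55's Witt tower: `x = [ζ̄]` (Teichmüller of a generator of `𝔽_{q²}/𝔽_q`),
`x + τx = [ζ̄] + [ζ̄^q]`, a unit because `ζ̄ + ζ̄^q ≠ 0` (`ζ̄ ∉ 𝔽_q`). -/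
theorem traceOne_of_unit_trace (τ : k' ≃ₐ[k] k') (hτ2 : ∀ x, τ (τ x) = x) {x : k'}
    (hx : ‖x‖ ≤ 1) (ht : ‖x + τ x‖ = 1) : TraceOne τ := by
  have hne : x + τ x ≠ 0 := by
    intro h; rw [h, norm_zero] at ht; exact zero_ne_one ht
  refine ⟨x * (x + τ x)⁻¹, ?_, ?_⟩
  · rw [norm_mul, norm_inv, ht, inv_one, mul_one]; exact hx
  · rw [map_mul, map_inv₀, map_add, hτ2, add_comm (τ x) x, ← add_mul, mul_inv_cancel₀ hne]

omit [IsUltrametricDist k] [ProperSpace k] in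
/-- **Dyadic form of (TR1): `τ` MOVES SOME INTEGER BY A UNIT.**  If `‖2‖ < 1` (frame `h2`) and
`‖x − τx‖ = 1` for some `‖x‖ ≤ 1`, then `‖x + τx‖ = 1` (the two differ by `2·τx`, of norm `< 1`), so
(TR1) holds.  `‖x − τx‖ = 1` for some integral `x` says exactly that `τ` acts non-trivially on the
residue field — i.e. the quadratic step is UNRAMIFIED; for the ramified steps `L_m/F_m` no such `x`
exists.  This is the whole "unramified" content of R213. -/
theorem traceOne_of_moved_by_unit (τ : k' ≃ₐ[k] k') (hτ2 : ∀ x, τ (τ x) = x)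
    (h2 : ‖(2 : k')‖ < 1) {x : k'} (hx : ‖x‖ ≤ 1) (h : ‖x - τ x‖ = 1) : TraceOne τ := by
  have hτx : ‖τ x‖ = ‖x‖ := norm_map_algHom ((τ : k' →ₐ[k] k').restrictScalars ℚ_[2]) x
  have hsmall : ‖2 * τ x‖ < 1 := by
    rw [norm_mul, hτx]
    exact lt_of_le_of_lt (mul_le_of_le_one_right (norm_nonneg _) hx) h2
  have hne : ‖x - τ x‖ ≠ ‖2 * τ x‖ := by rw [h]; exact hsmall.ne'
  have heq : x + τ x = (x - τ x) + 2 * τ x := by ring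
  refine traceOne_of_unit_trace τ hτ2 hx ?_
  rw [heq, IsUltrametricDist.norm_add_eq_max_of_norm_ne_norm hne, h, max_eq_left hsmall.le]

omit [NormedAlgebra ℚ_[2] k] [IsUltrametricDist k] [ProperSpace k] [NormedAlgebra ℚ_[2] k'] [IsUltrametricDist k']
  [ProperSpace k'] [IsScalarTower ℚ_[2] k k'] in
/-- **Layer `0`, all six keys, both towers: the datum is `−ζ₃`.**  `F_1 = ℚ₂(ζ₃)` and `L_1 = L_0(ζ₃)`
(B55), the step involution sends `ζ₃ ↦ ζ₃²`, and `(−ζ₃) + (−ζ₃²) = 1`: (TR1) at `m = 0` needs no datum beyond a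
primitive cube root of unity moved by `τ`.  (Steps `m ≥ 1`: any Teichmüller generator `a` of the residue
extension has `‖τ a − a‖ = 1`, and `traceOne_of_moved_by_unit` applies.) -/
theorem traceOne_of_cube_root (τ : k' ≃ₐ[k] k') {ζ : k'} (hζ3 : ζ ^ 3 = 1) (hζ1 : ζ ≠ 1)
    (hτζ : τ ζ = ζ ^ 2) : TraceOne τ := by
  have hn : ‖ζ‖ = 1 := by
    have h := congrArg (‖·‖) hζ3
    simp only [norm_pow, norm_one] at h
    exact (pow_eq_one_iff_of_nonneg (norm_nonneg ζ) (by norm_num)).1 h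
  have hq : ζ ^ 2 + ζ + 1 = 0 := by
    have h0 : (ζ - 1) * (ζ ^ 2 + ζ + 1) = 0 := by ring_nf; linear_combination hζ3
    rcases mul_eq_zero.1 h0 with h | h
    · exact absurd (sub_eq_zero.1 h) hζ1
    · exact h
  refine ⟨-ζ, by simpa using hn.le, ?_⟩
  rw [map_neg, hτζ]
  linear_combination (-1 : k') * hq

/-! ### One datum serves both towers: transporting (TR1) along `F_{m+1} ↪ L_{m+1}` -/

section Transport

variable {F F' : Type} [NontriviallyNormedField F] [NormedAlgebra ℚ_[2] F] [IsUltrametricDist F]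
  [ProperSpace F] [NontriviallyNormedField F'] [NormedAlgebra ℚ_[2] F'] [IsUltrametricDist F']
  [ProperSpace F'] [Algebra F F'] [IsScalarTower ℚ_[2] F F']

omit [NormedAlgebra ℚ_[2] k] [IsUltrametricDist k] [ProperSpace k] [NormedAlgebra ℚ_[2] k'] [IsUltrametricDist k']
  [ProperSpace k'] [IsScalarTower ℚ_[2] k k'] [NormedAlgebra ℚ_[2] F] [IsUltrametricDist F] [ProperSpace F]
  [NormedAlgebra ℚ_[2] F'] [IsUltrametricDist F'] [ProperSpace F'] [IsScalarTower ℚ_[2] F F'] in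
/-- **(TR1) for the `F`-step gives (TR1) for the `L`-step**: along any norm-non-increasing ring map
`φ : F_{m+1} → L_{m+1}` intertwining the two step involutions (`τ_m|F_{m+1}` = the `F`-step generator, frame
`hcomm`), `b ↦ φ b`.  So the typer instantiates ONE element `b_m ∈ F_{m+1}` per step (Witt currency:
`b_m = [ζ̄]·([ζ̄]+[ζ̄^q])⁻¹`, `ζ̄` a generator of `𝔽_{q²}/𝔽_q`) and gets (N-ONTO) on BOTH towers. -/
theorem traceOne_map (τF : F' ≃ₐ[F] F') (τL : k' ≃ₐ[k] k') (φ : F' →+* k')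
    (hc : ∀ b, τL (φ b) = φ (τF b)) (hφ : ∀ b, ‖φ b‖ ≤ ‖b‖) : TraceOne τF → TraceOne τL := by
  rintro ⟨b, hb, htr⟩
  refine ⟨φ b, (hφ b).trans hb, ?_⟩
  rw [hc, ← map_add, htr, map_one]

end Transport

end LevelPair

/-! ## §1c  The whole tower: the `hN` hypothesis of k3-g34 `tower_univNorm_eq_prQuot`, discharged
modulo one trace-one element per step -/

section WholeTower

variable {L : ℕ → Type} [∀ m, NontriviallyNormedField (L m)] [∀ m, NormedAlgebra ℚ_[2] (L m)]
  [∀ m, IsUltrametricDist (L m)] [∀ m, ProperSpace (L m)] [∀ m, Algebra (L m) (L (m + 1))]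
  [∀ m, IsScalarTower ℚ_[2] (L m) (L (m + 1))]

/-- `∀ m, NormOntoPrincipal (L m) (L (m+1))` — EXACTLY the `hN` binder of `tower_prQuot_subset_univNorm`
/ `tower_univNorm_eq_prQuot` (k3-g34 §4) — from the step involutions `τ m` (`N = 1 + τ`, frame `hNτ`
of R214) and one trace-one element `b m : L (m+1)` per step (frame datum (TR1), §2). -/
theorem tower_normOntoPrincipal (τ : ∀ m, L (m + 1) ≃ₐ[L m] L (m + 1))
    (hNτ : ∀ m (z : L (m + 1)), algebraMap (L m) (L (m + 1)) (Algebra.norm (L m) z) = z * τ m z)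
    (hb : ∀ m, TraceOne (τ m)) : ∀ m, NormOntoPrincipal (L m) (L (m + 1)) :=
  fun m => normOntoPrincipal_of_traceOne (τ m) (hNτ m) (hb m)

end WholeTower

/-! ## §3  The located kernel of `θ : (U_∞)_{χ_u} ↠ U_∞^{χ_u=sgn}` is NONZERO — unconditionally

(k2-g35 / row 102 built `θ = lim (1−σ)̄ : lim_N Q_m ↠ lim_N S_m` with `exists_coherent_lift` under `hker`; here the
complementary statement: a nonzero layer-`0` kernel class propagates to a nonzero coherent kernel element as soon as
the kernel transitions are ONTO — and they are, by (N-ONTO) on the `F`-tower (§1), with no LCFT.) -/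

section Kernel

universe u v

/-- **`θ` is NOT injective: a nonzero layer-`0` kernel class propagates up the tower** when the kernel
transitions are onto.  Dictionary: `A m = Q_m = U¹(L_m)/N_Δ U¹(L_m)` (the `χ_u`-COINVARIANT carrier, k2-g35),
`π m = δ_m = (1−σ_m)̄` onto `B m = D_m`, `ker π_m = Ĥ⁰(Δ_m, U¹(L_m)) = U¹(F_m)/N_Δ U¹(L_m)`, kernel transition =
`N_{F_{m+1}/F_m}` on representatives — ONTO by `normOntoPrincipal_of_traceOne` for the `F`-step (`hK`);
`x₀ =` the class of a layer-`0` non-norm unit of `ℤ₂` (§4).  So `ker θ = lim_N Ĥ⁰ ≠ 0` with NO appeal to C1/C2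
(LCFT); it is `2`-torsion (trivially), which is all `hext` (row 101 `comp_of_extend`) consumes. -/
theorem exists_coherent_kernel_ne_one {A : ℕ → Type u} {B : ℕ → Type v} [∀ m, CommGroup (A m)]
    [∀ m, CommGroup (B m)] (tA : ∀ m, A (m + 1) →* A m) (π : ∀ m, A m →* B m)
    (hK : ∀ m (x : A m), π m x = 1 → ∃ x' : A (m + 1), π (m + 1) x' = 1 ∧ tA m x' = x)
    {x₀ : A 0} (hx₀ : π 0 x₀ = 1) (hne : x₀ ≠ 1) :
    ∃ a : ∀ m, A m, (∀ m, tA m (a (m + 1)) = a m) ∧ (∀ m, π m (a m) = 1) ∧ a 0 ≠ 1 := by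
  classical
  let seq : ∀ m, {a : A m // π m a = 1} := fun m =>
    Nat.rec (motive := fun m => {a : A m // π m a = 1}) ⟨x₀, hx₀⟩
      (fun m x => ⟨(hK m x.1 x.2).choose, (hK m x.1 x.2).choose_spec.1⟩) m
  refine ⟨fun m => (seq m).1, fun m => ?_, fun m => (seq m).2, hne⟩
  show tA m (seq (m + 1)).1 = (seq m).1
  exact (hK m (seq m).1 (seq m).2).choose_spec.2

end Kernel

/-! ## §4  Layer `0`: `Ĥ⁰(σ₀, U¹(L₀)) ≠ 0` — units of `ℤ₂` that are not norms from `𝒪_{L₀} = ℤ₂[√u]`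
(`u ≢ 1 mod 4` for all six keys, so `𝒪_{L₀} = ℤ₂[√u]` and `N(a + b√u) = a² − u b²`; every unit of
`ℤ₂` is principal, `U¹(ℚ₂) = ℤ₂ˣ`).  Residues `mod 4` / `mod 8`, `decide`d; the `ℤ₂`-statement follows by
`PadicInt.toZModPow`. -/

section LayerZero

/-- `u = −1`: norms `a² + b²` are never `≡ 3 (mod 4)`; so `3, 7 ∈ ℤ₂ˣ` are non-norms. -/
theorem nonnorm_key_neg1 : ∀ a b : ZMod 4, a ^ 2 + b ^ 2 ≠ 3 := by decide

/-- `u = 3`: `a² − 3b² ≢ 3 (mod 4)`; so `3, 7` (`≡ −1`) are non-norms. -/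
theorem nonnorm_key_3 : ∀ a b : ZMod 4, a ^ 2 - 3 * b ^ 2 ≠ 3 := by decide

/-- `u = 2`: `a² − 2b² ≢ 3, 5 (mod 8)`. -/
theorem nonnorm_key_2 : ∀ a b : ZMod 8, a ^ 2 - 2 * b ^ 2 ≠ 3 ∧ a ^ 2 - 2 * b ^ 2 ≠ 5 := by decide

/-- `u = −2`: `a² + 2b² ≢ 5, 7 (mod 8)`. -/
theorem nonnorm_key_neg2 : ∀ a b : ZMod 8, a ^ 2 + 2 * b ^ 2 ≠ 5 ∧ a ^ 2 + 2 * b ^ 2 ≠ 7 := by decide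

/-- `u = 6`: `a² − 6b² ≢ 5, 7 (mod 8)`. -/
theorem nonnorm_key_6 : ∀ a b : ZMod 8, a ^ 2 - 6 * b ^ 2 ≠ 5 ∧ a ^ 2 - 6 * b ^ 2 ≠ 7 := by decide

/-- `u = −6`: `a² + 6b² ≢ 3, 5 (mod 8)`. -/
theorem nonnorm_key_neg6 : ∀ a b : ZMod 8, a ^ 2 + 6 * b ^ 2 ≠ 3 ∧ a ^ 2 + 6 * b ^ 2 ≠ 5 := by decide

/-- The `ℤ₂`-form for the key `u = 2` (the others are identical): `5 ∈ ℤ₂ˣ = U¹(ℚ₂)` is not a norm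
from `ℤ₂[√2]`, by reduction `ℤ₂ → ℤ/8` (`PadicInt.toZModPow 3`). -/
theorem padicInt_five_not_norm_key_2 (a b : ℤ_[2]) : a ^ 2 - 2 * b ^ 2 ≠ 5 := by
  intro h
  have h' := congrArg (PadicInt.toZModPow 3 : ℤ_[2] →+* ZMod (2 ^ 3)) h
  simp only [map_sub, map_mul, map_pow, map_ofNat] at h'
  have key : ∀ a b : ZMod (2 ^ 3), a ^ 2 - 2 * b ^ 2 ≠ 5 := by decide
  exact key _ _ h'

end LayerZero

end Summit.BirchSwinnertonDyer.BirchSwinnertonDyer.Cruxes.SplitBadTwoLowerHalfOfFacts.NormOntoK1G34
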